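import Summits.BirchSwinnertonDyer.BirchSwinnertonDyer.Theorems.CMKolyvaginAtInertTwoCMExactDescentAtTwoGeneral
import Literature.NumberTheory.EllipticCurves.KrizLi2019.SexticTwistBSDThreeDescent
import HarnessLib

/-!
# Route `ByReductionTypeAtTwo`, crux `RankOneAtTwoOffBigImageOddLocal` (stmt-BirchSwinnertonDyer-23716), line
# `refined_kolyvagin_tamagawa_shift_at_two`: the δ KERNEL — the SHIFTED exact `2`-adic Heegner descent (Manin-free, any Tamagawa parity)

Lead prover `prover-cruxlead-stmt-BirchSwinnertonDyer-23716-g0` (2026-08-28).  §2 of the registered skeleton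
`Cruxes/RankOneAtTwoOffBigImageOddLocal/Lines/refined_kolyvagin_tamagawa_shift_at_two.lean` (g6), landed as a `--supports` helper of the crux,
with the skeleton's abbreviation `sigmaShift W Dt` spelled out as `padicValNat 2 W.tamagawaProduct + padicValInt 2 Dt.c` (no definition here):

* `bsdp_two_of_card_sha_baseChange_eq_shifted` — the any-rank-`≤ 1` form;
* `bsdp_two_of_card_sha_baseChange_eq_shifted_rankOne` — the rank-ONE member the line's δ / S₃-locus glue consumes (`r_an(E) = 1`, `y_K`
  of infinite order ⟹ `L(E^{(d_K)},1) ≠ 0` by Gross–Zagier, so the twin has analytic rank `0` and `ord_{s=1} L(E/K,s) = 1`).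

This is the closing step of the line's K-side: the three Kolyvagin stubs (Σ-accumulation, stringent primitivity, shifted structure theorem)
produce exactly the hypothesis `#Ш(E/K)[2^∞] = 2^{2(M₀ − σ)}`; this file turns it into `BSD(W, 2)` given `BSD₂` of the rank-`0` twin.
The theses-cone warning on the import (route `CMKolyvaginAtInertTwo` via `…CMExactDescentAtTwo`) is inherited from the skeleton: the
descent lemmas it needs (`shaAnOverC_baseChange_eq_of_heegner`, `eq_zero_of_two_pow_smul_eq_zero_ringClassField`,
`exists_heegnerPoint_map_eq_derivedPoint_one`) live only there.  BSD is not proved by this; the crux is not proved by this (its seven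
registered stubs are untouched); conditional on the named print facts taken as hypotheses.

References: [GrossZagier1986] Thm. I.6.3, V.§2; [Milne1972ArithmeticAV] §1 Thm. 1; [Miller2011LMS] Def. 1.1; [GrossLMS1991] §4; [WZhang2014] §3.7.
-/

set_option linter.dupNamespace false -- tree convention: `Summit.BirchSwinnertonDyer.BirchSwinnertonDyer.Theorems` (summit = sub-problem)
set_option autoImplicit false
noncomputable section

open scoped Classical

namespace Summit.BirchSwinnertonDyer.BirchSwinnertonDyer.Theorems.OffBigImageOddLocalAtTwo

open WeierstrassCurve NumberField IsDedekindDomain Rat.HeightOneSpectrum Literature.NumberTheory.EllipticCurves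
  Literature.NumberTheory.EllipticCurves.ModularForms
  Literature.NumberTheory.EllipticCurves.Rank1Residual
  Literature.NumberTheory.EllipticCurves.Rank1Residual.Typed
  Literature.NumberTheory.EllipticCurves.KrizLi2019
  Summit.BirchSwinnertonDyer.Rank1Residual
  Summit.BirchSwinnertonDyer.Rank1Residual.AdditivePotMult
  Summit.BirchSwinnertonDyer.BirchSwinnertonDyer.Theorems.CMExactDescent

/-- **THE SHIFTED EXACT `2`-ADIC HEEGNER DESCENT.**  `CMExactDescent.bsdp_two_of_card_sha_baseChange_eq_of_facts` (p581565 family)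
with the binders `Odd ∏_ℓ c_ℓ(E)` and `Odd c(Dt)` DROPPED and their valuations CARRIED as the shift `σ := v₂ ∏_ℓ c_ℓ(W) + v₂ c(Dt)`:
for `W/ℚ` globally minimal with `ρ̄_{W,2}` onto and analytic rank `≤ 1`, `K` imaginary quadratic with odd `d_K ≠ −3` and the Heegner
hypothesis, `ord_{s=1} L(E/K, s) = 1`, ANY datum `Dt`, `β`, `ι` and conductor-`1` Kolyvagin datum `d₁` with `2^{M₀} ∥ P(1) = y_K` in
`E(K[1])`, `σ ≤ M₀`, `#Ш(E/K)[2^∞] = 2^{2(M₀ − σ)}`, and a globally minimal model `Wd` of `E^{(d_K)}` of analytic rank `≤ 1` with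
`BSD(Wd, 2)`: THEN `BSD(W, 2)`.  Mechanism: Gross–Zagier at the Heegner point `P₀ ∈ E(K)` below `P(1)` gives
`#Ш_an(E/K) = 4·[E(K):ℤP₀]²/(c² w_K² (∏c_ℓ)²)` (`shaAnOverC_baseChange_eq_of_heegner`); no `2`-torsion in `E(K[1])`
(`eq_zero_of_two_pow_smul_eq_zero_ringClassField`, from `ρ̄₂` onto, `d_K` odd) makes `ord₂ [E(K):ℤP₀] = M₀`; `w_K = 2`; so
`ord₂ #Ш_an(E/K) = 2M₀ − 2σ = ord₂ #Ш(E/K)`, and the `2`-part over `K` descends to `ℚ` through Milne's quadratic base-change quotient and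
`BSD(Wd, 2)` (`bsdp_of_pPartOverC_baseChange`).  Named print facts are hypotheses (Gross–Zagier, GZK, modularity, Milne 1972 any model).
[cite: GrossZagier1986, Thm. I.6.3 and V.§2] [cite: Milne1972ArithmeticAV, §1 Thm. 1] [cite: Miller2011LMS, Def. 1.1] -/
theorem bsdp_two_of_card_sha_baseChange_eq_shifted
    (W : WeierstrassCurve ℚ) [W.IsElliptic] [W.IsGloballyMinimal] [NeZero (W.conductorNorm ℤ)]
    (K : Type) [Field K] [NumberField K]
    (Dt : ModularParametrizationData W (W.conductorNorm ℤ)) (β : ℤ) (ι : K →+* ℂ)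
    (d₁ : KolyvaginHeegnerData Dt β ι 1)
    (Wd : WeierstrassCurve ℚ) [Wd.IsElliptic] [Wd.IsGloballyMinimal]
    (hGZ : gross_zagier (W.conductorNorm ℤ) W K)
    (hGZK : rank_eq_analyticRank_of_analyticRank_le_one) (hmod : hasEntireLFunction_rat)
    (hMilneC : Milne1972.bsdQuotient_baseChange_quadratic_anyModel)
    (hρ : W.HasSurjectiveModNGaloisRep 2) (hr : W.analyticRank ≤ 1)
    (hK : IsImaginaryQuadratic K) (hodd : Odd (NumberField.discr K)) (h3 : NumberField.discr K ≠ -3)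
    (hH : SatisfiesHeegnerHypothesis (W.conductorNorm ℤ) K)
    (hrK : (W.baseChange K).analyticRank = 1) {M₀ : ℕ}
    (hdiv : ∃ Q : (W.baseChange (ringClassField K ι 1)).toAffine.Point,
      ((2 ^ M₀ : ℕ) : ℤ) • Q = d₁.derivedPoint)
    (hndiv : ¬ ∃ Q : (W.baseChange (ringClassField K ι 1)).toAffine.Point,
      ((2 ^ (M₀ + 1) : ℕ) : ℤ) • Q = d₁.derivedPoint)
    (hσ : (padicValNat 2 W.tamagawaProduct + padicValInt 2 Dt.c) ≤ M₀)
    (hsha : Nat.card (AddCommGroup.primaryComponent (W.baseChange K).sha 2) = 2 ^ (2 * (M₀ - (padicValNat 2 W.tamagawaProduct + padicValInt 2 Dt.c))))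
    (hWd : ∃ C : VariableChange ℚ, C • W.quadraticTwist (NumberField.discr K : ℚ) = Wd)
    (hrd : Wd.analyticRank ≤ 1) (hBd : BSDp Wd 2) : BSDp W 2 := by
  haveI : Fact (Nat.Prime 2) := ⟨Nat.prime_two⟩
  haveI hEK : (W.baseChange K).IsElliptic := isElliptic_baseChange' W K
  have h2 : Module.finrank ℚ K = 2 := hK.1
  obtain ⟨-, hDlt⟩ := discr_emod_four_and_lt_of_odd hK hodd h3
  have hw2 : Units.torsionOrder K = 2 :=
    Literature.NumberTheory.QuadraticFields.Quadratic.torsionOrder_eq_two_of_discr_lt_neg_four h2 hDlt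
  have hc0 : Dt.c ≠ 0 := Dt.maninConstant_ne_zero_holds
  -- the Heegner point `P₀ ∈ E(K)` below `P(1)`, for the datum `Dt`
  obtain ⟨P₀, Hd, hP₀, hP₀K⟩ := exists_heegnerPoint_map_eq_derivedPoint_one hK hH d₁
  -- the exact identity over `K`
  obtain ⟨hrkK, hShaK, hPinf, hshaC⟩ := shaAnOverC_baseChange_eq_of_heegner W K Dt Hd ι P₀ hGZ
    hGZK hmod hK hH hP₀ hc0 hrK
  haveI hfinK : Finite (W.baseChange K).sha := hShaK
  -- `ord₂ [E(K) : ℤP₀] = M₀`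
  have htor1 : ∀ (M : ℕ) (R : (W.baseChange (ringClassField K ι 1)).toAffine.Point),
      ((2 ^ M : ℕ) : ℤ) • R = 0 → R = 0 :=
    fun M R hR ↦ eq_zero_of_two_pow_smul_eq_zero_ringClassField W hK hodd hH hρ ι M R hR
  have hdivK : ∃ Q : (W.baseChange K).toAffine.Point, ((2 ^ M₀ : ℕ) : ℤ) • Q = P₀ :=
    (X11b.Three.Koly.pDiv_one_iff_exists_zsmul_eq hK d₁ P₀ hP₀K 2 M₀ (htor1 M₀)).mp hdiv
  have hndivK : ¬ ∃ Q : (W.baseChange K).toAffine.Point, ((2 ^ (M₀ + 1) : ℕ) : ℤ) • Q = P₀ :=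
    fun h ↦ hndiv ((X11b.Three.Koly.pDiv_one_iff_exists_zsmul_eq hK d₁ P₀ hP₀K 2 (M₀ + 1)
      (htor1 (M₀ + 1))).mpr h)
  have hiv : ∀ x : (W.baseChange K).toAffine.Point, 2 • x = 0 → x = 0 :=
    fun x hx ↦ eq_zero_of_two_smul_eq_zero_baseChange W hK hodd hH hρ x hx
  haveI : Finite (AddCommGroup.torsion (W.baseChange K).toAffine.Point) :=
    WeierstrassCurve.finite_torsion_point (W := W.baseChange K)
  obtain ⟨cc, Q, hcQ, hcker⟩ :=
    X11b.RankOne.exists_coord_of_mordellWeilRank_eq_one (W.baseChange K) hrkK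
  have hidx : padicValNat 2 (AddSubgroup.zmultiples P₀).index = M₀ :=
    X11b.Three.Koly.padicValNat_index_zmultiples_eq_of_divisibility (p := 2) cc Q hcQ hcker hiv P₀
      hdivK hndivK
  -- `ord₂ #Ш_an(W ⊗ K) = 2 M₀ - 2σ = ord₂ #Ш(W ⊗ K)`
  set I := (AddSubgroup.zmultiples P₀).index with hI_def
  have hI0 : I ≠ 0 := fun hI ↦ by
    have hh := P2.torsionOrder_sq_mul_canonicalHeight_eq_index_sq_mul_regulator (W.baseChange K)
      hrkK P₀ hPinf
    rw [← hI_def, hI, Nat.cast_zero, zero_pow two_ne_zero, zero_mul, mul_eq_zero,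
      pow_eq_zero_iff two_ne_zero, Nat.cast_eq_zero] at hh
    exact hh.elim (W.baseChange K).torsionOrder_pos_holds.ne'
      (fun h0 ↦ hPinf ((Affine.Point.canonicalHeight_eq_zero_iff_holds P₀).mp h0))
  set q : ℚ := 4 * (I : ℚ) ^ 2 /
      ((Dt.c : ℚ) ^ 2 * (Units.torsionOrder K : ℚ) ^ 2 * ((W.tamagawaProduct : ℚ) ^ 2)) with hq_def
  have hcQ0 : (Dt.c : ℚ) ≠ 0 := by exact_mod_cast hc0
  have hcW0 : (W.tamagawaProduct : ℚ) ≠ 0 := by exact_mod_cast W.tamagawaProduct_pos_holds.ne'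
  have hIQ0 : (I : ℚ) ≠ 0 := by exact_mod_cast hI0
  have hq' : q = ((I : ℚ) / ((Dt.c : ℚ) * (W.tamagawaProduct : ℚ))) ^ 2 := by
    rw [hq_def, hw2]
    push_cast
    field_simp
    ring
  have hvc : padicValRat 2 (Dt.c : ℚ) = (padicValInt 2 Dt.c : ℤ) := padicValRat.of_int
  have hvcW : padicValRat 2 (W.tamagawaProduct : ℚ) = (padicValNat 2 W.tamagawaProduct : ℤ) := padicValRat.of_nat
  have hval : padicValRat 2 q = 2 * (M₀ : ℤ) - 2 * ((padicValNat 2 W.tamagawaProduct + padicValInt 2 Dt.c) : ℤ) := by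
    rw [hq', padicValRat.pow, padicValRat.div hIQ0 (mul_ne_zero hcQ0 hcW0),
      padicValRat.mul hcQ0 hcW0, hvc, hvcW, padicValRat.of_nat, hidx]
    push_cast
    ring
  have hshaV : padicValNat 2 (W.baseChange K).shaOrder = 2 * (M₀ - (padicValNat 2 W.tamagawaProduct + padicValInt 2 Dt.c)) := by
    rw [X11b.Three.Koly.padicValNat_shaOrder_eq (W.baseChange K) 2, hsha, padicValNat.prime_pow]
  have hKin : MissingPPartOverCAt (W.baseChange K) 2 :=
    ⟨q, hshaC, by rw [hval, hshaV, Nat.cast_mul, Nat.cast_sub hσ]; push_cast; ring⟩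
  exact bsdp_of_pPartOverC_baseChange W 2 K Wd hGZK hmod hMilneC hr h2 hWd hrd hKin hBd

/-- **The rank-ONE member of the shifted descent** (the shape the δ composition uses): `r_an(E) = 1` and `y_K = P(1)` of infinite
order; then `L′(E/K,1) = L′(E,1)·L(E^{(d_K)},1) ≠ 0` (Gross–Zagier at `P₀`), so `r_an(E^{(d_K)}) = 0`, `ord_{s=1} L(E_K,s) = 1`, and
`bsdp_two_of_card_sha_baseChange_eq_shifted` applies. [cite: GrossZagier1986, V.§2 (p. 312)] [cite: Miller2011LMS, Def. 1.1] -/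
theorem bsdp_two_of_card_sha_baseChange_eq_shifted_rankOne
    (W : WeierstrassCurve ℚ) [W.IsElliptic] [W.IsGloballyMinimal] [NeZero (W.conductorNorm ℤ)]
    (K : Type) [Field K] [NumberField K]
    (Dt : ModularParametrizationData W (W.conductorNorm ℤ)) (β : ℤ) (ι : K →+* ℂ)
    (d₁ : KolyvaginHeegnerData Dt β ι 1)
    (Wd : WeierstrassCurve ℚ) [Wd.IsElliptic] [Wd.IsGloballyMinimal]
    (hGZ : gross_zagier (W.conductorNorm ℤ) W K)
    (hGZK : rank_eq_analyticRank_of_analyticRank_le_one) (hmod : hasEntireLFunction_rat)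
    (hMilneC : Milne1972.bsdQuotient_baseChange_quadratic_anyModel)
    (hρ : W.HasSurjectiveModNGaloisRep 2) (hr : W.analyticRank = 1)
    (hK : IsImaginaryQuadratic K) (hodd : Odd (NumberField.discr K)) (h3 : NumberField.discr K ≠ -3)
    (hH : SatisfiesHeegnerHypothesis (W.conductorNorm ℤ) K)
    (hy : ¬ IsOfFinAddOrder d₁.derivedPoint) {M₀ : ℕ}
    (hdiv : ∃ Q : (W.baseChange (ringClassField K ι 1)).toAffine.Point,
      ((2 ^ M₀ : ℕ) : ℤ) • Q = d₁.derivedPoint)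
    (hndiv : ¬ ∃ Q : (W.baseChange (ringClassField K ι 1)).toAffine.Point,
      ((2 ^ (M₀ + 1) : ℕ) : ℤ) • Q = d₁.derivedPoint)
    (hσ : (padicValNat 2 W.tamagawaProduct + padicValInt 2 Dt.c) ≤ M₀)
    (hsha : Nat.card (AddCommGroup.primaryComponent (W.baseChange K).sha 2) = 2 ^ (2 * (M₀ - (padicValNat 2 W.tamagawaProduct + padicValInt 2 Dt.c))))
    (hWd : ∃ C : VariableChange ℚ, C • W.quadraticTwist (NumberField.discr K : ℚ) = Wd)
    (hBd : BSDp Wd 2) : BSDp W 2 := by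
  have h2 : Module.finrank ℚ K = 2 := hK.1
  have hD0 : (NumberField.discr K : ℚ) ≠ 0 := by exact_mod_cast NumberField.discr_ne_zero K
  haveI hEt : (W.quadraticTwist (NumberField.discr K : ℚ)).IsElliptic :=
    W.isElliptic_quadraticTwist hD0
  obtain ⟨P₀, Hd, hP₀, hP₀K⟩ := exists_heegnerPoint_map_eq_derivedPoint_one hK hH d₁
  have hPinf : ¬ IsOfFinAddOrder P₀ := by
    intro hfin
    apply hy
    rw [← hP₀K]
    exact (WeierstrassCurve.Affine.Point.map (W' := W)
      (algebraMap K (ringClassField K ι 1)).toRatAlgHom).isOfFinAddOrder hfin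
  have hLK : LDerivEK W K ≠ 0 :=
    (lDerivEK_ne_zero_iff_not_isOfFinAddOrder W (W.conductorNorm ℤ) K hGZ hK hH
      ⟨Dt, Hd, ι, hP₀⟩).mpr hPinf
  have hL0 : W.entireLFunction 1 = 0 := entireLFunction_one_eq_zero_of_analyticRank_eq_one hr
  have hLt : (W.quadraticTwist (NumberField.discr K : ℚ)).entireLFunction 1 ≠ 0 := by
    intro h0
    apply hLK
    rw [lDerivEK_eq_deriv_mul W K hmod hL0, h0, mul_zero]
  have hrt : (W.quadraticTwist (NumberField.discr K : ℚ)).analyticRank = 0 :=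
    ((W.quadraticTwist _).analyticRank_eq_zero_iff_holds (hmod _)).mpr hLt
  have hrd : Wd.analyticRank = 0 := by
    obtain ⟨Cd, hCd⟩ := hWd
    rw [← hCd, analyticRank_smul, hrt]
  have hrK : (W.baseChange K).analyticRank = 1 :=
    (P2.analyticRank_baseChange_eq_one_iff W K hmod h2).mpr (Or.inl ⟨hr, hrt⟩)
  exact bsdp_two_of_card_sha_baseChange_eq_shifted W K Dt β ι d₁ Wd hGZ hGZK hmod hMilneC hρ hr.le
    hK hodd h3 hH hrK hdiv hndiv hσ hsha hWd (by rw [hrd]; exact zero_le_one) hBd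

end Summit.BirchSwinnertonDyer.BirchSwinnertonDyer.Theorems.OffBigImageOddLocalAtTwo

end
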